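import Literature.MathematicalPhysics.QuantumLattice.PlaquettePairCouplings
import Literature.MathematicalPhysics.QuantumLattice.FockRelabel
import Literature.MathematicalPhysics.QuantumLattice.TwoSpeciesSectorForms
import Summits.HubbardSuperconductivity.HubbardSuperconductivity.Theses.CooperPairDMottWalk

/-!
# Route `CooperPairDMottWalk`, support `PlaquettePairBinding`: a computable model of the plaquette

Helper file for item stmt-HubbardSuperconductivity-1181 (certified exact diagonalisation of the
`2 × 2` Hubbard plaquette `plaquetteHamiltonian U = hubbardTorus 2 2 1 U`). The site type of the
tree, `PlaquetteSite = FermionTorus 2 2 = Lex (Fin 2 → Fin 2)`, carries Mathlib's NONCOMPUTABLE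
lexicographic linear order (`Pi.Lex`, `Classical.decRel`), so no Jordan–Wigner sign or `Finset`
operation on it can be evaluated by the kernel. We therefore relabel the plaquette along the
bijection `siteEquiv : Fin 4 ≃ PlaquetteSite`, `k ↦ (k % 2, k / 2)` (Mathlib's
`finFunctionFinEquiv` composed with `FermionTorus.equivTorusSite`), onto the computable site type
`Fin 4` with the pulled-back graph `plaqGraph4 = plaquetteGraph.comap siteEquiv` (the 4-cycle
`0 ∼ 1 ∼ 3 ∼ 2 ∼ 0`): by the tree's covariance of the Hubbard Hamiltonian
(`FermionRelabelling.relabel_hamiltonian`) `plaquetteHamiltonian U = Γ H₄(U) Γᴴ` with the signed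
permutation unitary `Γ = relabelMatrix (Orb.mapEquiv siteEquiv)` (`HyperoctahedralFockAction`).
This file records the vector-level transport along `Γ` (inner products, eigenvectors, and the
sectors `(N↑, N↓) = (a, b)`), so that all certificates can be computed for
`ham4 U = hamiltonian plaqGraph4 1 U` and transported back.

No new mathematics: Bratteli–Robinson II, Thm. 5.2.5 (unitarily implemented orbital bijections),
as already formalised in `FermionRelabelling` / `HyperoctahedralFockAction`.
-/

set_option linter.dupNamespace false

noncomputable section

namespace Summit.HubbardSuperconductivity.HubbardSuperconductivity.Theorems.CooperPairDMottWalk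

open Literature.MathematicalPhysics.QuantumLattice Literature.MathematicalPhysics.QuantumLattice.TwoSpecies
open Matrix Finset

/-! ### Transport of vectors along a relabelling (generic) -/

section Transport

variable {ι ι' : Type*} [LinearOrder ι] [Fintype ι] [LinearOrder ι'] [Fintype ι'] (e : ι ≃ ι')

omit [Fintype ι'] in
/-- `Γ |ψ⟩` on relabelled configurations: `(Γ ψ)(e s) = ε(s) ψ(s)`. [folklore] -/
theorem relabelMatrix_mulVec_apply (ψ : Fock ι) (s : Finset ι) :
    (relabelMatrix e *ᵥ ψ) (e.finsetCongr s) = relabelSign e s * ψ s := by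
  rw [mulVec, dotProduct]
  simp only [relabelMatrix_apply_finsetCongr, ite_mul, zero_mul, Finset.sum_ite_eq, Finset.mem_univ,
    if_true]

/-- `Γᴴ |ψ'⟩` in the original configurations: `(Γᴴ ψ')(s) = ε(s) ψ'(e s)`. [folklore] -/
theorem conjTranspose_relabelMatrix_mulVec_apply (ψ' : Fock ι') (s : Finset ι) :
    ((relabelMatrix e)ᴴ *ᵥ ψ') s = relabelSign e s * ψ' (e.finsetCongr s) := by
  rw [mulVec, dotProduct, ← e.finsetCongr.sum_comp]
  simp only [conjTranspose_apply, relabelMatrix_apply_finsetCongr]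
  rw [Finset.sum_eq_single s]
  · rw [if_pos rfl, star_relabelSign]
  · intro t _ hts
    rw [if_neg hts, star_zero, zero_mul]
  · exact fun h => absurd (mem_univ _) h

/-- `Γᴴ Γ ψ = ψ`. [folklore] -/
theorem conjTranspose_relabelMatrix_mulVec_relabelMatrix_mulVec (ψ : Fock ι) :
    (relabelMatrix e)ᴴ *ᵥ (relabelMatrix e *ᵥ ψ) = ψ := by
  rw [mulVec_mulVec, conjTranspose_mul_relabelMatrix, one_mulVec]

/-- `Γ Γᴴ ψ' = ψ'`. [folklore] -/
theorem relabelMatrix_mulVec_conjTranspose_mulVec (ψ' : Fock ι') :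
    relabelMatrix e *ᵥ ((relabelMatrix e)ᴴ *ᵥ ψ') = ψ' := by
  rw [mulVec_mulVec, relabelMatrix_mul_conjTranspose, one_mulVec]

/-- `Γ` is isometric: `⟨Γψ, Γφ⟩ = ⟨ψ, φ⟩`. [folklore] -/
theorem star_relabelMatrix_mulVec_dotProduct (ψ φ : Fock ι) :
    star (relabelMatrix e *ᵥ ψ) ⬝ᵥ (relabelMatrix e *ᵥ φ) = star ψ ⬝ᵥ φ := by
  rw [star_mulVec, ← dotProduct_mulVec, mulVec_mulVec, conjTranspose_mul_relabelMatrix, one_mulVec]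

/-- `Γᴴ` is isometric: `⟨Γᴴψ', Γᴴφ'⟩ = ⟨ψ', φ'⟩`. [folklore] -/
theorem star_conjTranspose_relabelMatrix_mulVec_dotProduct (ψ' φ' : Fock ι') :
    star ((relabelMatrix e)ᴴ *ᵥ ψ') ⬝ᵥ ((relabelMatrix e)ᴴ *ᵥ φ') = star ψ' ⬝ᵥ φ' := by
  rw [star_mulVec, conjTranspose_conjTranspose, ← dotProduct_mulVec, mulVec_mulVec,
    relabelMatrix_mul_conjTranspose, one_mulVec]

/-- Mixed form: `⟨Γᴴψ', φ⟩ = ⟨ψ', Γ φ⟩`. [folklore] -/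
theorem star_conjTranspose_relabelMatrix_mulVec_dotProduct' (ψ' : Fock ι') (φ : Fock ι) :
    star ((relabelMatrix e)ᴴ *ᵥ ψ') ⬝ᵥ φ = star ψ' ⬝ᵥ (relabelMatrix e *ᵥ φ) := by
  rw [star_mulVec, conjTranspose_conjTranspose, ← dotProduct_mulVec]

/-- The relabelled operator acts on relabelled vectors: `(Γ A Γᴴ)(Γ ψ) = Γ (A ψ)`. [folklore] -/
theorem relabel_mulVec_relabelMatrix_mulVec (A : Matrix (Finset ι) (Finset ι) ℂ) (ψ : Fock ι) :
    relabel e A *ᵥ (relabelMatrix e *ᵥ ψ) = relabelMatrix e *ᵥ (A *ᵥ ψ) := by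
  rw [relabel_eq_relabelMatrix_mul, mulVec_mulVec, Matrix.mul_assoc, Matrix.mul_assoc,
    conjTranspose_mul_relabelMatrix, Matrix.mul_one, ← mulVec_mulVec]

/-- Pulling back: `A (Γᴴ ψ') = Γᴴ ((Γ A Γᴴ) ψ')`. [folklore] -/
theorem mulVec_conjTranspose_relabelMatrix_mulVec (A : Matrix (Finset ι) (Finset ι) ℂ) (ψ' : Fock ι') :
    A *ᵥ ((relabelMatrix e)ᴴ *ᵥ ψ') = (relabelMatrix e)ᴴ *ᵥ (relabel e A *ᵥ ψ') := by
  rw [relabel_eq_relabelMatrix_mul, mulVec_mulVec, mulVec_mulVec, ← Matrix.mul_assoc,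
    ← Matrix.mul_assoc, conjTranspose_mul_relabelMatrix, Matrix.one_mul]

/-- `Γᴴ ψ' = 0 ↔ ψ' = 0`. [folklore] -/
theorem conjTranspose_relabelMatrix_mulVec_eq_zero_iff (ψ' : Fock ι') :
    (relabelMatrix e)ᴴ *ᵥ ψ' = 0 ↔ ψ' = 0 := by
  constructor
  · intro h
    rw [← relabelMatrix_mulVec_conjTranspose_mulVec e ψ', h, mulVec_zero]
  · rintro rfl; exact mulVec_zero _

end Transport

/-! ### Sectors under site bijections -/

section Sectors

variable {Λ Λ' : Type*} [LinearOrder Λ] [Fintype Λ] [LinearOrder Λ'] [Fintype Λ'] (f : Λ ≃ Λ')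

omit [LinearOrder Λ] [Fintype Λ] [LinearOrder Λ'] [Fintype Λ'] in
/-- `(Orb.mapEquiv f)⁻¹ (x', σ) = (f⁻¹ x', σ)`. [folklore] -/
theorem mapEquiv_symm_orb (x' : Λ') (σ : Fin 2) :
    (Orb.mapEquiv f).symm (orb x' σ) = orb (f.symm x') σ :=
  (Orb.mapEquiv f).injective (by simp)

/-- Up-spin sites of a relabelled configuration. [folklore] -/
theorem upPart_finsetCongr_mapEquiv (s : Finset (Orb Λ)) :
    upPart ((Orb.mapEquiv f).finsetCongr s) = (upPart s).map f.toEmbedding := by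
  ext x'
  rw [mem_upPart, Equiv.finsetCongr_apply, Finset.mem_map_equiv, Finset.mem_map_equiv, mem_upPart,
    mapEquiv_symm_orb]

/-- Down-spin sites of a relabelled configuration. [folklore] -/
theorem downPart_finsetCongr_mapEquiv (s : Finset (Orb Λ)) :
    downPart ((Orb.mapEquiv f).finsetCongr s) = (downPart s).map f.toEmbedding := by
  ext x'
  rw [mem_downPart, Equiv.finsetCongr_apply, Finset.mem_map_equiv, Finset.mem_map_equiv,
    mem_downPart, mapEquiv_symm_orb]

/-- `Γ` maps the sector `(a, b)` to the sector `(a, b)`. [folklore] -/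
theorem isInSector_relabelMatrix_mulVec {a b : ℕ} {ψ : Fock (Orb Λ)} (hψ : IsInSector a b ψ) :
    IsInSector a b (relabelMatrix (Orb.mapEquiv f) *ᵥ ψ) := by
  intro s' hs'
  obtain ⟨s, rfl⟩ := (Orb.mapEquiv f).finsetCongr.surjective s'
  rw [relabelMatrix_mulVec_apply, hψ s, mul_zero]
  rwa [upPart_finsetCongr_mapEquiv, downPart_finsetCongr_mapEquiv, card_map, card_map] at hs'

/-- `Γᴴ` maps the sector `(a, b)` to the sector `(a, b)`. [folklore] -/
theorem isInSector_conjTranspose_relabelMatrix_mulVec {a b : ℕ} {ψ' : Fock (Orb Λ')}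
    (hψ' : IsInSector a b ψ') : IsInSector a b ((relabelMatrix (Orb.mapEquiv f))ᴴ *ᵥ ψ') := by
  intro s hs
  rw [conjTranspose_relabelMatrix_mulVec_apply, hψ' _, mul_zero]
  rwa [upPart_finsetCongr_mapEquiv, downPart_finsetCongr_mapEquiv, card_map, card_map]

end Sectors

/-! ### The plaquette relabelled onto `Fin 4` -/

/-- The site bijection `Fin 4 ≃ PlaquetteSite`, `k ↦ (k % 2, k / 2)`:
`0 ↦ (0,0)`, `1 ↦ (1,0)`, `2 ↦ (0,1)`, `3 ↦ (1,1)` (Mathlib's `finFunctionFinEquiv`, then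
`FermionTorus.equivTorusSite`). [folklore] -/
def siteEquiv : Fin 4 ≃ PlaquetteSite :=
  (finFunctionFinEquiv (m := 2) (n := 2)).symm.trans (FermionTorus.equivTorusSite (d := 2) (L := 2)).symm

/-- The plaquette graph pulled back to `Fin 4`: the 4-cycle `0 ∼ 1 ∼ 3 ∼ 2 ∼ 0` (adjacency is
decidable and kernel-computable through the torus coordinates). [folklore] -/
abbrev plaqGraph4 : SimpleGraph (Fin 4) := plaquetteGraph.comap siteEquiv

/-- The orbital bijection `(k, σ) ↦ (siteEquiv k, σ)`. [folklore] -/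
abbrev orbEquiv : Orb (Fin 4) ≃ Orb PlaquetteSite := Orb.mapEquiv siteEquiv

/-- The plaquette Hubbard Hamiltonian in the `Fin 4` model (`t = 1`). [folklore] -/
abbrev ham4 (U : ℝ) : Matrix (Finset (Orb (Fin 4))) (Finset (Orb (Fin 4))) ℂ := hamiltonian plaqGraph4 1 U

/-- The signed permutation unitary `Γ` from the `Fin 4` model to the plaquette. [folklore] -/
abbrev gam : Matrix (Finset (Orb PlaquetteSite)) (Finset (Orb (Fin 4))) ℂ := relabelMatrix orbEquiv

/-- **`plaquetteHamiltonian U = Γ H₄(U) Γᴴ`** (covariance of the Hubbard Hamiltonian under the graph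
isomorphism `siteEquiv`). [folklore] -/
theorem relabel_ham4 (U : ℝ) : relabel orbEquiv (ham4 U) = plaquetteHamiltonian U :=
  relabel_hamiltonian plaqGraph4 plaquetteGraph siteEquiv (fun _ _ => Iff.rfl) 1 U

/-- Pull-back of the action: `H₄ (Γᴴ ψ') = Γᴴ (H_plaq ψ')`. [folklore] -/
theorem ham4_mulVec_pull (U : ℝ) (ψ' : Fock (Orb PlaquetteSite)) :
    ham4 U *ᵥ (gamᴴ *ᵥ ψ') = gamᴴ *ᵥ (plaquetteHamiltonian U *ᵥ ψ') := by
  rw [mulVec_conjTranspose_relabelMatrix_mulVec, relabel_ham4]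

/-- Push-forward of the action: `H_plaq (Γ ψ) = Γ (H₄ ψ)`. [folklore] -/
theorem plaquetteHamiltonian_mulVec_push (U : ℝ) (ψ : Fock (Orb (Fin 4))) :
    plaquetteHamiltonian U *ᵥ (gam *ᵥ ψ) = gam *ᵥ (ham4 U *ᵥ ψ) := by
  rw [← relabel_ham4, relabel_mulVec_relabelMatrix_mulVec]

/-- Transport of expectation values: `⟨Γψ, H_plaq Γψ⟩ = ⟨ψ, H₄ ψ⟩` and `‖Γψ‖ = ‖ψ‖`. [folklore] -/
theorem expect_push (U : ℝ) (ψ : Fock (Orb (Fin 4))) :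
    star (gam *ᵥ ψ) ⬝ᵥ (plaquetteHamiltonian U *ᵥ (gam *ᵥ ψ)) = star ψ ⬝ᵥ (ham4 U *ᵥ ψ) ∧
      star (gam *ᵥ ψ) ⬝ᵥ (gam *ᵥ ψ) = star ψ ⬝ᵥ ψ := by
  rw [plaquetteHamiltonian_mulVec_push, star_relabelMatrix_mulVec_dotProduct,
    star_relabelMatrix_mulVec_dotProduct]
  exact ⟨rfl, rfl⟩

/-- Transport of an eigenvector of the plaquette to the `Fin 4` model: `Γᴴ ψ'` is an eigenvector of
`H₄` with the same eigenvalue, the same norm, the same sector, and it is nonzero iff `ψ'` is.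
[folklore] -/
theorem eigen_pull (U : ℝ) {E : ℂ} {ψ' : Fock (Orb PlaquetteSite)}
    (h : plaquetteHamiltonian U *ᵥ ψ' = E • ψ') :
    ham4 U *ᵥ (gamᴴ *ᵥ ψ') = E • (gamᴴ *ᵥ ψ') ∧
      star (gamᴴ *ᵥ ψ') ⬝ᵥ (gamᴴ *ᵥ ψ') = star ψ' ⬝ᵥ ψ' := by
  rw [ham4_mulVec_pull, h, mulVec_smul, star_conjTranspose_relabelMatrix_mulVec_dotProduct]
  exact ⟨rfl, rfl⟩

end Summit.HubbardSuperconductivity.HubbardSuperconductivity.Theorems.CooperPairDMottWalk
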